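import Summits.HodgeConjecture.HodgeConjecture.Theses.HeckePrymWeil
import Summits.HodgeConjecture.HodgeConjecture.Theorems.HeckePrymWeilWeilTwelvefoldsSqrtMinus7HodgeModelFacts
import Summits.HodgeConjecture.HodgeConjecture.Theorems.HeckePrymWeilWeilSixfoldsSqrtMinus7HodgeTypeExterior
import Summits.HodgeConjecture.HodgeConjecture.Theorems.HeckePrymWeilWeilDescendingUpward
import Summits.HodgeConjecture.HodgeConjecture.Theorems.HeckePrymWeilProductDescentTransfer
import Literature.AlgebraicGeometry.HodgeTheory.AlgebraicClassesCupAbelianVariety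
import Literature.AlgebraicGeometry.Motives.ComplexPointsOrientation
import Literature.AlgebraicGeometry.Motives.AimedSplitProduct
import HarnessLib

/-!
# `AimedDescending` (stmt-HodgeConjecture-14643) from two named facts — the lever of the split of crux `WeilSixfoldsSqrtMinus7` (stmt-1260), in every dimension

Route `HeckePrymWeil`, line `hyperbolic-eightfold-descent` of the crux `WeilSixfoldsSqrtMinus7`
(stmt-HodgeConjecture-1260). The route closes that crux through the glued split
`EightfoldDescentGlue : HyperbolicEightfoldsSqrtMinus7 → AimedDescending → WeilSixfoldsSqrtMinus7`
(stmt-14751); the line's own composition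
(`Theorems/HeckePrymWeilWeilSixfoldsSqrtMinus7OfHyperbolicEightfolds`) discharged the lever at
`(p, n) = (7, 3)`. This file proves the lever `Theses.HeckePrymWeil.AimedDescending` ITSELF — for
every prime `p ≡ 3 (4)`, `p ≥ 7`, and every `n ≥ 1` — GRANTED the same two Literature NAMED FACTS
(D-0014), and nothing else:

1. `Literature.AlgebraicGeometry.Motives.exists_cmWeilSurface_aimedSplitProduct` — the aiming lemma
   of the Schoen/Koike/Markman product trick in the route's polarised carrier typing (a CM Weil surface
   `B` with a descent pair such that `A × B`, suitably embedded, is of split Weil type for the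
   `K`-symmetrised hyperplane class; Markman arXiv:2509.23403 §11.5 Step 2, van Geemen LNM 1594
   5.2 (3), 5.3, 5.4, Schoen Compositio 114 §10);
2. `Literature.NumberTheory.Transcendental.exists_deRhamIsoFamily` — de Rham's theorem in
   multiplicative form (Warner 5.36/5.45), through the Künneth-for-Hodge-types theorem
   `HyperbolicEightfoldDescent.stub_hodgeTypeExterior` (with `nonempty_hodgeModel_all_holds`).

Proof (Markman §11.5 Step 2; Schoen §10; Koike 2004 Thm 2.1): given `(A, φ)` of dimension `2n` with
`φ ≫ φ = -p` and a rational `(n,n)` Weil class `c`; `c = 0` is algebraic; otherwise `c` witnesses Weil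
type and fact 1 (at `d = p`) yields the surface `(B, ψ)`, its descent pair `(b₊, b₋, η)` and a
projective embedding `e` of `A × B` with a rational `a ≠ 0` making `(A × B, φ × ψ)` hyperbolic in
half-dimension `n + 1`; the SPLIT-RUNG hypothesis of `AimedDescending` at `m = n + 1` then makes every
rational `(n+1,n+1)` Weil class of `(A × B, φ × ψ)` algebraic, and Schoen's descent — the tree's
`weilEigencomponents_mem_algebraicClasses_of_rung` (rational Weil projector),
`AbelianVariety.cupProduct_mem_algebraicClasses_one` (moving `η` by translations),
`complexGysin_fst_map_snd_ne_zero` (fibre integral of a non-zero top class) and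
`mem_algebraicClasses_of_complexGysin_fst_cupProduct` (real Gysin + projection formula), exactly as in
`productDescent_of` / `HyperbolicEightfoldDescent.stub_descent` — returns `c` algebraic.

With `EightfoldDescentGlue` (pure logic) this gives a second derivation of the landed
`weilSixfoldsSqrtMinus7_of_hyperbolicEightfolds` (same statement, not restated here).

What this does NOT do: it closes no item (conditional result); the split rungs themselves
(`HyperbolicEightfoldsSqrtMinus7` at `(7, 3)`, nothing known in dimension `≥ 8`) are untouched.
-/

noncomputable section

-- single-problem summit (Problem = Summit): the mandated namespace repeats `HodgeConjecture`.
set_option linter.dupNamespace false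

open CategoryTheory
open Literature.AlgebraicGeometry Literature.AlgebraicGeometry.Motives
  Literature.AlgebraicGeometry.HodgeTheory Literature.AlgebraicTopology.SingularHomology
open Summit.HodgeConjecture.HodgeConjecture.Theorems

namespace Summit.HodgeConjecture.HodgeConjecture.Theorems.WeilSixfoldsSqrtMinus7.HyperbolicEightfoldDescent

/-- **`AimedDescending` from the two named facts** (`exists_cmWeilSurface_aimedSplitProduct`,
`exists_deRhamIsoFamily`): for `p ≡ 3 (4)` prime, `p ≥ 7`, `n ≥ 1`, if the Hodge–Weil classes are
algebraic on every SPLIT `ℚ(√-p)`-Weil abelian variety of dimension `2n + 2` (hyperbolic for the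
`K`-symmetrised hyperplane class of some projective embedding), then they are algebraic on every
`ℚ(√-p)`-Weil abelian variety of dimension `2n`, all discriminants (Markman arXiv:2509.23403 §11.5
Step 2; Schoen 1998 §10; Koike 2004). See the module docstring for the proof. -/
theorem aimedDescending_of_facts :
    Literature.AlgebraicGeometry.Motives.exists_cmWeilSurface_aimedSplitProduct →
    (∀ (E : Type) [NormedAddCommGroup E] [NormedSpace ℂ E] [FiniteDimensional ℂ E],
      Literature.NumberTheory.Transcendental.exists_deRhamIsoFamily (modelWithCornersSelf ℝ E)) →
    Summit.HodgeConjecture.HodgeConjecture.Theses.HeckePrymWeil.AimedDescending := by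
  intro hF hdR p _hp _hp4 hp7 n hn hsplit A φ hA hφ c hc hcH hcW
  by_cases hc0 : c = 0
  · rw [hc0]
    exact Submodule.zero_mem _
  have hp0 : 0 < p := by omega
  have hp4 : 4 ≤ p := by omega
  -- the partner surface, its descent pair, and the aimed embedding of `A × B` (fact 1 at `d = p`)
  obtain ⟨B, ψ, hB, hψ, ⟨bp, bm, η, hbp, hbm, hbr, hbH, hη, hpt, hmt⟩, haim⟩ := hF p hp0
  obtain ⟨e, a, har, ha0, hhyp⟩ := haim n A φ hA hφ ⟨c, hc0, hc, hcH, hcW⟩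
  -- the compatible endomorphism `Φ = φ × ψ` of the product, `Φ² = -p`, `dim (A × B) = 2 (n + 1)`
  have hdim : (A.prod B).dim = 2 * (n + 1) := by rw [AbelianVariety.dim_prod, hA, hB]; ring
  have hsq := prodLift_comp_self_eq_neg_zsmul hφ hψ
  -- the split rung at `m = n + 1`, applied to `(A × B, Φ)` through the aimed embedding
  have halgAB := hsplit (n + 1) rfl (A.prod B) _ hdim hsq e a har ha0 hhyp
  -- smoothness witnesses and the orientation family
  have hA' : Motives.IsSmoothProjective (2 * n) A.X := isSmoothProjective_of_dim_eq hA
  have hB' : Motives.IsSmoothProjective (2 * 1) B.X := isSmoothProjective_of_dim_eq hB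
  have hAB : Motives.IsSmoothProjective (2 * (n + 1)) (A.prod B).X :=
    isSmoothProjective_prod_two_mul hA' hB'
  let μ : OrientationFamily := fun _ _ h ↦
    Classical.choice (Motives.ComplexPoints.isOrientableOver ℂ h)
  -- `c = c₊ + c₋` along the two eigenvalues
  obtain ⟨cp, hcp, cm, hcm, rfl⟩ := Submodule.mem_sup.1 hcW
  rw [Module.End.mem_eigenspace_iff] at hcp hcm hbp hbm
  have h₁ : Motives.AbelianVariety.prodLift (Motives.AbelianVariety.fst A B ≫ φ)
        (Motives.AbelianVariety.snd A B ≫ ψ) ≫ Motives.AbelianVariety.fst A B =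
      Motives.AbelianVariety.fst A B ≫ φ :=
    Motives.AbelianVariety.prodLift_fst _ _
  have h₂ : Motives.AbelianVariety.prodLift (Motives.AbelianVariety.fst A B ≫ φ)
        (Motives.AbelianVariety.snd A B ≫ ψ) ≫ Motives.AbelianVariety.snd A B =
      Motives.AbelianVariety.snd A B ≫ ψ :=
    Motives.AbelianVariety.prodLift_snd _ _
  have h : 2 * n + 2 * 1 = 2 * (n + 1) := by ring
  -- Hodge type `(n+1, n+1)` of `P = pr_A^* c ⌣ pr_B^*(b₊ + b₋)` (Künneth for Hodge types, fact 2)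
  have hH : IsOfHodgeType (2 * (n + 1)) (A.prod B).X (2 * (n + 1)) (n + 1) (n + 1)
      (cupProduct h
        (complexBetti.map (Motives.AbelianVariety.fst A B).hom.hom.hom (2 * n) (cp + cm))
        (complexBetti.map (Motives.AbelianVariety.snd A B).hom.hom.hom (2 * 1) (bp + bm))) :=
    stub_hodgeTypeExterior
      (fun m Y => WeilTwelvefoldsSqrtMinus7.AmnesicSecantSheaves.nonempty_hodgeModel_all_holds m Y)
      hdR A B (2 * n) (2 * 1) hA hB (2 * n) (2 * 1) (2 * (n + 1)) h n n 1 1 (cp + cm) (bp + bm)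
      hcH hbH
  have hbp' : complexBetti.map (𝟙 B + ψ).hom.hom.hom (2 * 1) bp =
      (1 + Complex.I * (Real.sqrt (p : ℝ) : ℂ)) ^ (2 * 1) • bp := hbp
  have hbm' : complexBetti.map (𝟙 B + ψ).hom.hom.hom (2 * 1) bm =
      (1 - Complex.I * (Real.sqrt (p : ℝ) : ℂ)) ^ (2 * 1) • bm := hbm
  -- upward half: `pr_A^* c± ⌣ pr_B^* b±` are algebraic on `A × B`
  obtain ⟨hP, hMm⟩ := weilEigencomponents_mem_algebraicClasses_of_rung h₁ h₂ hp4 hn h hAB halgAB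
    hcp hcm hbp' hbm' hc hbr hH
  -- `pr_B^* η` is algebraic on `A × B`, hence so are `(pr_A^* c± ⌣ pr_B^* b±) ⌣ pr_B^* η`
  have hη' : complexBetti.map (Motives.AbelianVariety.snd A B).hom.hom.hom (2 * 1) η ∈
      algebraicClasses (A.prod B).X 1 :=
    map_snd_mem_supportedClasses hA' hB' hη
  have halgp := AbelianVariety.cupProduct_mem_algebraicClasses_one (A.prod B) hP hη'
  have halgm := AbelianVariety.cupProduct_mem_algebraicClasses_one (A.prod B) hMm hη'
  -- the fibre integrals `pr_{A*} pr_B^*(b± ⌣ η) ≠ 0`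
  have hjj' : 2 * 1 + 2 * 1 = 2 * (2 * 1) := rfl
  have hpt' : cupProduct hjj' bp η ≠ 0 := hpt
  have hmt' : cupProduct hjj' bm η ≠ 0 := hmt
  have hnep := complexGysin_fst_map_snd_ne_zero μ hA' hB' hpt'
  have hnem := complexGysin_fst_map_snd_ne_zero μ hA' hB' hmt'
  -- Schoen's transfer, component by component
  refine Submodule.add_mem _ ?_ ?_
  · exact mem_algebraicClasses_of_complexGysin_fst_cupProduct μ hA' hB' (l := n) (j := 2 * 1)
      (j' := 2 * 1) (s := 2 * (n + 1)) h hjj' hnep halgp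
  · exact mem_algebraicClasses_of_complexGysin_fst_cupProduct μ hA' hB' (l := n) (j := 2 * 1)
      (j' := 2 * 1) (s := 2 * (n + 1)) h hjj' hnem halgm

end Summit.HodgeConjecture.HodgeConjecture.Theorems.WeilSixfoldsSqrtMinus7.HyperbolicEightfoldDescent
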